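import Literature.Computability.Cryptography.InaccessibleEntropyUOWHFProgram
import Literature.Computability.Cryptography.InaccessibleEntropyUOWHF
import Literature.Computability.Cryptography.AffineHashThreewise
import HarnessLib

/-!
# One-way functions ⇒ UOWHF, machine layer IV: the candidates as an instance of the combinatorial analysis

Topic `Literature/Computability/Cryptography`; twelfth file of the "one-way functions ⇒ universal one-way
hash functions" line (Haitner–Holenstein–Reingold–Vadhan–Wee 2020, proof of Thm. 5.1). The combinatorial
analysis (`InaccessibleEntropyUOWHF.lean`, `CandData`, `CandData.card_tcr_le` / `tcr_prob_le`) is stated over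
abstract finite types; the string functions `blockStr`, `F1Str`, `F2Str`, `F3Str`, `candStr` of
`InaccessibleEntropyUOWHFProgram.lean` are what the machines compute. This file instantiates the former on
bit-vector types and proves that, through the evident fixed-length binary codes (`BitCodecs.lean`), the
string functions ARE the abstract maps:

* the types at security parameter `n` and grid index `j`: `𝒳 = {0,1}ⁿ`, `𝒦 = {0,1}^{ℓK}`, `Fin M`,
  `P = 𝔽₂^M`, `W = ({0,1}ⁿ × {0,1}^{ℓK} × Fin M)^t`, `G₂ = {0,1}^{|G₂|}`, `R₂ = 𝔽₂^{ℓ_j}`, `G₃ = {0,1}^{|G₃|}`,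
  `R₃ = 𝔽₂^{r₃}`, `D = 𝔽₂^N`; their codecs (`codecD`, `codecW`, `codecBlk`, `codecIn2`, `codecIn3`, `zvec`);
* `cand f n j : CandData …` — `f` on vectors, the hashed prefix `affinePrefix n M ℓK pad` (Thm. 4.5 with the
  affine family of `AffineHashStrings.lean`), the smoothing hash `g₂ ↦ hashV (t d₀) ℓ_j g₂` on coded tuples,
  the final hash `g₃ ↦ hashV m₂ r₃ g₃` on coded `F₂`-outputs, and the parsing equivalence `e : 𝔽₂^N ≃ (W × G₂) × G₃`;
* **the correspondence** (for length-preserving `f`): `blockStr_enc`, `F1Str_enc`, `F2Str_enc`, `F3Str_enc`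
  and `candStr_enc : candStr f n j (encZ y) (encZ x) = encOut3 ((cand f n j).fam y x)`, with `encOut3` injective
  — so designated collisions of the string candidate are exactly designated collisions of `fam`;
* **the hypotheses of `CandData.tcr_prob_le` that concern the instance**: `prefixPairwise_cand`,
  `isPairwiseIndep_h₂`, `isThreewiseIndep_h₂`, `isPairwiseIndep_h₃` (from the two- and three-wise independence of
  the affine family and injectivity of the codes) and the cardinalities `card_W_G2`, `card_R3`, `two_mul_card_R3`.

All statements proved; no named facts.

## References

* I. Haitner, T. Holenstein, O. Reingold, S. Vadhan, H. Wee, *Inaccessible Entropy II: IE Functions and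
  Universal One-Way Hashing*, Theory of Computing 16(8) (2020), Thm. 4.5 and proof of Thm. 5.1, Steps 1–4;
  §2.4 (explicit two- and three-wise independent families).
* O. Goldreich, *Foundations of Cryptography II*, CUP 2004, §6.4.3.2 (Thm. 6.4.29).
-/

namespace Literature.Computability.Cryptography

namespace HHRVW

open _root_.Computability Complexity Complexity.BitCodec AffineStr Sz Finset
open Complexity.Stockmeyer (bz bz_injective)

/-! ### `𝔽₂`-vectors as bit strings: the codec `zvec` and the algebra of `encZ` -/

/-- `𝔽₂^k`, coded by `encZ` (bit `q` is `[v q = 1]`), parsed by `bz` of the bits. [folklore] -/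
def zvec (k : ℕ) : BitCodec (Fin k → ZMod 2) where
  len := k
  enc := encZ k
  dec l := fun q => bz (l.getD q false)
  length_enc := length_encZ k
  dec_enc v := by
    funext q
    simp only [encZ, List.getD_eq_getElem?_getD, List.getElem?_ofFn, Fin.is_lt, Fin.eta, dite_true, Option.getD_some,
      bz_decide]
  enc_dec l hl := by
    subst hl
    apply List.ext_getElem (by simp [encZ])
    intro q h1 h2
    simp only [encZ, List.getElem_ofFn, List.getD_eq_getElem?_getD, List.getElem?_eq_getElem h2, Option.getD_some,
      bz_eq_one_iff, Bool.decide_eq_true]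

/-- `(zvec k).enc = encZ k`. [folklore] -/
@[simp] theorem zvec_enc (k : ℕ) (v : Fin k → ZMod 2) : (zvec k).enc v = encZ k v := rfl
/-- `(zvec k).len = k`. [folklore] -/
@[simp] theorem zvec_len (k : ℕ) : (zvec k).len = k := rfl

/-- Bits of `encZ`. [folklore] -/
theorem getElem_encZ {k : ℕ} (v : Fin k → ZMod 2) {q : ℕ} (hq : q < (encZ k v).length) :
    (encZ k v)[q] = decide (v ⟨q, by simpa using hq⟩ = 1) := by
  simp [encZ, List.getElem_ofFn]

/-- **`encZ` of a zero-padded prefix** is the cut-and-padded prefix of `encZ`. [folklore] -/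
theorem encZ_prefixZ {k : ℕ} (i : ℕ) (v : Fin k → ZMod 2) : encZ k (prefixZ i v) = fitLen k ((encZ k v).take i) := by
  rw [fitLen_take (length_encZ k v)]
  apply List.ext_getElem
  · simp only [length_encZ, List.length_append, List.length_take, List.length_replicate]; omega
  · intro q h1 h2
    rw [length_encZ] at h1
    rw [getElem_encZ]
    by_cases hqi : q < i
    · rw [List.getElem_append_left (by rw [List.length_take, length_encZ]; omega), List.getElem_take, getElem_encZ]
      simp [prefixZ, hqi]
    · rw [List.getElem_append_right (by rw [List.length_take, length_encZ]; omega), List.getElem_replicate]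
      simp [prefixZ, hqi]

/-- **`hashStr` on an `m`-bit string is the coded `𝔽₂`-hash** of the corresponding vector (`hashStr_toList` with
the vector codec's parser). [folklore] -/
theorem hashStr_eq_encZ {m k : ℕ} (σ : List Bool) {y : List Bool} (hy : y.length = m) :
    hashStr m k σ y = encZ k (hashV m k σ ((BitCodec.vector m).dec y)) := by
  rw [← hashStr_toList m k σ ((BitCodec.vector m).dec y), vector_dec_toList m hy]

/-- **Bitwise `xor` of codes is the code of the sum** in `𝔽₂^k`. [folklore] -/
theorem zipWith_xor_encZ {k : ℕ} (y x : Fin k → ZMod 2) : List.zipWith xor (encZ k y) (encZ k x) = encZ k (y + x) := by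
  apply List.ext_getElem
  · simp
  · intro q h1 h2
    rw [List.getElem_zipWith, getElem_encZ, getElem_encZ, getElem_encZ]
    have key : ∀ a b : ZMod 2, (decide (a = 1) ^^ decide (b = 1)) = decide (a + b = 1) := by decide
    exact key _ _

/-! ### The types and codecs of the instance -/

section Instance

variable (n : ℕ)

/-- Inputs of `f`: `{0,1}ⁿ`. [cite: HaitnerEtAl2020, Thm. 4.5] -/
abbrev Xv := List.Vector Bool n
/-- Keys of the row hash: `{0,1}^{ℓK}`. [cite: HaitnerEtAl2020, Thm. 4.5] -/
abbrev Kv := List.Vector Bool (lK n)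
/-- Points `(x, κ, i)` of the domain of the base function. [cite: HaitnerEtAl2020, Thm. 4.5] -/
abbrev Dom := Xv n × Kv n × Fin (M n)
/-- Hashed prefixes `𝔽₂^M`. [cite: HaitnerEtAl2020, Thm. 4.5] -/
abbrev Pv := Fin (M n) → ZMod 2
/-- Output blocks `(z, κ, i)` of the base function. [cite: HaitnerEtAl2020, Thm. 4.5] -/
abbrev Blk := Pv n × Kv n × Fin (M n)
/-- `t`-tuples of domain points (inputs of `F₁`, `F₂`). [cite: HaitnerEtAl2020, proof of Thm. 5.1, Step 1] -/
abbrev Wv := Fin (t n) → Dom n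
/-- `t`-tuples of output blocks. [cite: HaitnerEtAl2020, proof of Thm. 5.1, Step 1] -/
abbrev WoutV := Fin (t n) → Blk n
/-- Keys of the smoothing hash. [cite: HaitnerEtAl2020, proof of Thm. 5.1, Step 2] -/
abbrev G2v := List.Vector Bool (G2 n)
/-- Values of the smoothing hash of candidate `j`: `𝔽₂^{ℓ_j}`. [cite: HaitnerEtAl2020, proof of Thm. 5.1, Step 2] -/
abbrev R2v (j : ℕ) := Fin (ell n j) → ZMod 2
/-- Keys of the final hash. [cite: HaitnerEtAl2020, proof of Thm. 5.1, Step 3] -/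
abbrev G3v := List.Vector Bool (G3 n)
/-- Values of the final hash: `𝔽₂^{r₃}`. [cite: HaitnerEtAl2020, proof of Thm. 5.1, Step 3] -/
abbrev R3v := Fin (r3 n) → ZMod 2
/-- The shift domain `𝔽₂^N` of Step 4. [cite: HaitnerEtAl2020, proof of Thm. 5.1, Step 4] -/
abbrev Dv := Fin (N n) → ZMod 2

/-- Codec of the prefix length `i ∈ Fin M = Fin (2^a)`: `a`-bit numerals. [cite: HaitnerEtAl2020, Thm. 4.5] -/
def finM : BitCodec (Fin (M n)) := finPow (a n)

/-- Bookkeeping lemma (record accessors, codec lengths). [folklore] -/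
@[simp] theorem finM_len : (finM n).len = a n := rfl

/-- The numeral of the code of `i` is `i`. [folklore] -/
theorem bitsToNat_finM_enc (i : Fin (M n)) : bitsToNat ((finM n).enc i) = i := bitsToNat_finPow_enc (a n) i

/-- Codec of a domain point: `x ++ κ ++ bin_a(i)` (`d₀` bits). [cite: HaitnerEtAl2020, Thm. 4.5] -/
def codecD : BitCodec (Dom n) :=
  ofEquiv (((BitCodec.vector n).prod (BitCodec.vector (lK n))).prod (finM n)) (Equiv.prodAssoc _ _ _)

/-- Codec of an output block: `encZ z ++ κ ++ bin_a(i)` (`blk` bits). [cite: HaitnerEtAl2020, Thm. 4.5] -/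
def codecBlk : BitCodec (Blk n) :=
  ofEquiv (((zvec (M n)).prod (BitCodec.vector (lK n))).prod (finM n)) (Equiv.prodAssoc _ _ _)

/-- Codec of a `t`-tuple of domain points (`t·d₀` bits). [cite: HaitnerEtAl2020, proof of Thm. 5.1, Step 1] -/
def codecW : BitCodec (Wv n) := (codecD n).pi (t n)

/-- Codec of a `t`-tuple of output blocks (`t·blk` bits). [cite: HaitnerEtAl2020, proof of Thm. 5.1, Step 1] -/
def codecWout : BitCodec (WoutV n) := (codecBlk n).pi (t n)

/-- Codec of an input of `F₂` (`n₂` bits). [cite: HaitnerEtAl2020, proof of Thm. 5.1, Step 2] -/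
def codecIn2 : BitCodec (Wv n × G2v n) := (codecW n).prod (BitCodec.vector (G2 n))

/-- Codec of an input of `F₃` (`N` bits). [cite: HaitnerEtAl2020, proof of Thm. 5.1, Step 3] -/
def codecIn3 : BitCodec ((Wv n × G2v n) × G3v n) := (codecIn2 n).prod (BitCodec.vector (G3 n))

/-- Bookkeeping lemma (record accessors, codec lengths). [folklore] -/
@[simp] theorem codecD_len : (codecD n).len = d0 n := rfl
/-- Bookkeeping lemma (record accessors, codec lengths). [folklore] -/
@[simp] theorem codecBlk_len : (codecBlk n).len = blk n := rfl
/-- Bookkeeping lemma (record accessors, codec lengths). [folklore] -/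
@[simp] theorem codecW_len : (codecW n).len = t n * d0 n := rfl
/-- Bookkeeping lemma (record accessors, codec lengths). [folklore] -/
@[simp] theorem codecWout_len : (codecWout n).len = t n * blk n := rfl
/-- Bookkeeping lemma (record accessors, codec lengths). [folklore] -/
@[simp] theorem codecIn2_len : (codecIn2 n).len = n2 n := rfl
/-- Bookkeeping lemma (record accessors, codec lengths). [folklore] -/
@[simp] theorem codecIn3_len : (codecIn3 n).len = N n := rfl

/-- The code of a domain point. [folklore] -/
theorem codecD_enc (z : Dom n) : (codecD n).enc z = z.1.toList ++ z.2.1.toList ++ (finM n).enc z.2.2 := rfl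

/-- The code of an output block. [folklore] -/
theorem codecBlk_enc (q : Blk n) : (codecBlk n).enc q = encZ (M n) q.1 ++ q.2.1.toList ++ (finM n).enc q.2.2 := rfl

variable (j : ℕ)

/-- The string code of an output of `F₂`: `F₁`-blocks, `g₂`, and the smoothing-hash value padded to `ℓmax`
(`m₂` bits; injective, not surjective). [cite: HaitnerEtAl2020, proof of Thm. 5.1, Step 2] -/
def encOut2 (u : WoutV n × G2v n × R2v n j) : List Bool :=
  (codecWout n).enc u.1 ++ (u.2.1.toList ++ fitLen (lmax n) (encZ (ell n j) u.2.2))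

/-- `|encOut2 u| = m₂`. [folklore] -/
@[simp] theorem length_encOut2 (u : WoutV n × G2v n × R2v n j) : (encOut2 n j u).length = m2 n := by
  rw [encOut2, List.length_append, List.length_append, (codecWout n).length_enc, codecWout_len, List.Vector.toList_length,
    length_fitLen, m2, add_assoc]

/-- `encOut2` is injective when `ℓ_j ≤ ℓmax`. [folklore] -/
theorem encOut2_injective (hj : ell n j ≤ lmax n) : Function.Injective (encOut2 n j) := by
  intro u u' h
  have hl : ((codecWout n).enc u.1).length = ((codecWout n).enc u'.1).length := by
    rw [(codecWout n).length_enc, (codecWout n).length_enc]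
  have h' : (codecWout n).enc u.1 ++ (u.2.1.toList ++ fitLen (lmax n) (encZ (ell n j) u.2.2)) =
      (codecWout n).enc u'.1 ++ (u'.2.1.toList ++ fitLen (lmax n) (encZ (ell n j) u'.2.2)) := h
  obtain ⟨h1, h2⟩ := List.append_inj h' hl
  have hl2 : u.2.1.toList.length = u'.2.1.toList.length := by rw [List.Vector.toList_length, List.Vector.toList_length]
  obtain ⟨h3, h4⟩ := List.append_inj h2 hl2
  have hr : encZ (ell n j) u.2.2 = encZ (ell n j) u'.2.2 := by
    have h5 := congrArg (List.take (ell n j)) h4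
    have e1 : ∀ r : R2v n j, (fitLen (lmax n) (encZ (ell n j) r)).take (ell n j) = encZ (ell n j) r := fun r => by
      rw [fitLen, List.take_append_of_le_length (by rw [List.length_take, length_encZ, min_eq_right hj]),
        List.take_take, min_eq_left hj, List.take_of_length_le (by rw [length_encZ])]
    rwa [e1, e1] at h5
  exact Prod.ext ((codecWout n).enc_injective h1) (Prod.ext (List.Vector.toList_injective h3) (encZ_injective _ hr))

/-- The string code of an output of `F₃` / of a candidate: `g₃ ++ encZ(value)` (`N − 1` bits). [cite: HaitnerEtAl2020, proof of Thm. 5.1, Step 3] -/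
def encOut3 (q : G3v n × R3v n) : List Bool := q.1.toList ++ encZ (r3 n) q.2

/-- `|encOut3 q| = N − 1`. [folklore] -/
@[simp] theorem length_encOut3 (q : G3v n × R3v n) : (encOut3 n q).length = Nm1 n := by
  rw [encOut3, List.length_append, List.Vector.toList_length, length_encZ, Nm1, add_comm]

/-- `encOut3` is injective. [folklore] -/
theorem encOut3_injective : Function.Injective (encOut3 n) := by
  intro q q' h
  have hl : q.1.toList.length = q'.1.toList.length := by rw [List.Vector.toList_length, List.Vector.toList_length]
  have h' : q.1.toList ++ encZ (r3 n) q.2 = q'.1.toList ++ encZ (r3 n) q'.2 := h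
  obtain ⟨h1, h2⟩ := List.append_inj h' hl
  exact Prod.ext (List.Vector.toList_injective h1) (encZ_injective _ h2)

/-! ### The instance -/

variable (f : List Bool → List Bool)

/-- Cut-and-pad to an `n`-bit vector (injective on `n`-bit strings). [folklore] -/
def padV (y : List Bool) : Xv n := (BitCodec.vector n).dec y

/-- Parsing `𝔽₂^N` as an input of `F₃` (through the code `encZ`). [cite: HaitnerEtAl2020, proof of Thm. 5.1, Step 4] -/
def eFun (d : Dv n) : (Wv n × G2v n) × G3v n := (codecIn3 n).dec ((zvec (N n)).enc d)

/-- The inverse parsing. [cite: HaitnerEtAl2020, proof of Thm. 5.1, Step 4] -/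
def eInv (v : (Wv n × G2v n) × G3v n) : Dv n := (zvec (N n)).dec ((codecIn3 n).enc v)

/-- `eInv ∘ eFun = id`. [folklore] -/
theorem eInv_eFun (d : Dv n) : eInv n (eFun n d) = d := by
  unfold eInv eFun
  have h : ((zvec (N n)).enc d).length = (codecIn3 n).len := by
    rw [(zvec (N n)).length_enc, zvec_len]; exact (codecIn3_len n).symm
  rw [(codecIn3 n).enc_dec _ h]
  exact (zvec (N n)).dec_enc d

/-- `eFun ∘ eInv = id`. [folklore] -/
theorem eFun_eInv (v : (Wv n × G2v n) × G3v n) : eFun n (eInv n v) = v := by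
  unfold eInv eFun
  have h : ((codecIn3 n).enc v).length = (zvec (N n)).len := by rw [(codecIn3 n).length_enc, codecIn3_len, zvec_len]
  rw [(zvec (N n)).enc_dec _ h, (codecIn3 n).dec_enc]

/-- The parsing equivalence `𝔽₂^N ≃ (W × G₂) × G₃`. [cite: HaitnerEtAl2020, proof of Thm. 5.1, Step 4] -/
def eEquiv : Dv n ≃ (Wv n × G2v n) × G3v n := ⟨eFun n, eInv n, eInv_eFun n, eFun_eInv n⟩

/-- **The candidate of grid index `j` as an instance of `CandData`**: `f` on `{0,1}ⁿ`; the hashed prefix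
`hp κ i y = (h_κ(y))_{<i}` by the affine family; `h₂ = ` the `ℓ_j`-bit affine hash of the coded tuple;
`h₃ = ` the `r₃`-bit affine hash of the coded `F₂`-output; `e = ` parsing of `𝔽₂^N`.
[cite: HaitnerEtAl2020, Thm. 4.5 and proof of Thm. 5.1, Steps 1–4] -/
noncomputable def cand : CandData (Xv n) (List Bool) (Kv n) (Pv n) (G2v n) (R2v n j) (G3v n) (R3v n) (Dv n) (M n) (t n) where
  f x := f x.toList
  hp := affinePrefix n (M n) (lK n) (padV n)
  h₂ g w := hashV (t n * d0 n) (ell n j) g.toList ⟨(codecW n).enc w, (codecW n).length_enc w⟩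
  h₃ g u := hashV (m2 n) (r3 n) g.toList ⟨encOut2 n j u, length_encOut2 n j u⟩
  e := eEquiv n

variable {n j f}

/-- `(cand f n j).e d` parses the code of `d`. [folklore] -/
theorem cand_e_apply (d : Dv n) : (cand n j f).e d = (codecIn3 n).dec ((zvec (N n)).enc d) := rfl

/-- The code of `e d` is `encZ d` (written with the codec `zvec`, whose encoder is `encZ`). [folklore] -/
theorem enc_cand_e (d : Dv n) : (codecIn3 n).enc ((cand n j f).e d) = (zvec (N n)).enc d := by
  rw [cand_e_apply]
  have h : ((zvec (N n)).enc d).length = (codecIn3 n).len := by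
    rw [(zvec (N n)).length_enc, zvec_len]; exact (codecIn3_len n).symm
  exact (codecIn3 n).enc_dec _ h

/-! ### The string functions are the abstract maps on codes -/

/-- **The base block**: `blockStr f n (code z) = code (F z)` for length-preserving `f`. [cite: HaitnerEtAl2020, Thm. 4.5] -/
theorem blockStr_enc (hf : IsLengthPreserving f) (z : Dom n) :
    blockStr f n ((codecD n).enc z) = (codecBlk n).enc (baseF (cand n j f).f (cand n j f).hp (M n) z) := by
  rcases z with ⟨x, κ, i⟩
  have hx : x.toList.length = n := List.Vector.toList_length x
  have hκ : κ.toList.length = lK n := List.Vector.toList_length κ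
  have hi : ((finM n).enc i).length = a n := (finM n).length_enc i
  have hfx : (f x.toList).length = n := by rw [hf, hx]
  set ib := (finM n).enc i with hib
  have h1 : (x.toList ++ κ.toList ++ ib).take n = x.toList := by
    rw [List.append_assoc, List.take_append_of_le_length hx.ge, List.take_of_length_le hx.le]
  have h2 : ((x.toList ++ κ.toList ++ ib).drop n).take (lK n) = κ.toList := by
    rw [List.append_assoc, List.drop_append_of_le_length hx.ge, List.drop_of_length_le hx.le, List.nil_append,
      List.take_append_of_le_length hκ.ge, List.take_of_length_le hκ.le]
  have h3 : ((x.toList ++ κ.toList ++ ib).drop (n + lK n)).take (a n) = ib := by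
    rw [show n + lK n = (x.toList ++ κ.toList).length by rw [List.length_append, hx, hκ], List.drop_left,
      List.take_of_length_le hi.le]
  have hdec : (cand n j f).hp κ i ((cand n j f).f x) = prefixZ i (hashV n (M n) κ.toList ((BitCodec.vector n).dec (f x.toList))) := rfl
  rw [codecD_enc, blockStr]
  simp only
  rw [h1, h2, h3, bitsToNat_finM_enc, hashStr_eq_encZ _ hfx, ← encZ_prefixZ, codecBlk_enc, baseF]
  simp only
  rw [hdec, List.append_assoc]

/-- **Step 1**: `F1Str f n (code w) = code (F₁ w)`. [cite: HaitnerEtAl2020, proof of Thm. 5.1, Step 1] -/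
theorem F1Str_enc (hf : IsLengthPreserving f) (w : Wv n) : F1Str f n ((codecW n).enc w) = (codecWout n).enc ((cand n j f).F₁ w) := by
  rw [F1Str, codecWout, pi_enc]
  refine ccat_congr fun b hb => ?_
  rw [dif_pos hb, show d0 n = (codecD n).len from rfl, codecW, pi_enc_block (codecD n) (t n) w ⟨b, hb⟩, blockStr_enc hf]
  rfl

/-- **Step 2**: `F2Str f n j (code (w, g)) = encOut2 (F₂ (w, g))`. [cite: HaitnerEtAl2020, proof of Thm. 5.1, Step 2] -/
theorem F2Str_enc (hf : IsLengthPreserving f) (u : Wv n × G2v n) :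
    F2Str f n j ((codecIn2 n).enc u) = encOut2 n j ((cand n j f).F₂ u) := by
  rcases u with ⟨w, g⟩
  have hw : ((codecW n).enc w).length = t n * d0 n := (codecW n).length_enc w
  have hg : g.toList.length = G2 n := List.Vector.toList_length g
  have hdec : (BitCodec.vector (t n * d0 n)).dec ((codecW n).enc w) = ⟨(codecW n).enc w, (codecW n).length_enc w⟩ :=
    List.Vector.toList_injective (vector_dec_toList _ hw)
  have hh : hashStr (t n * d0 n) (ell n j) g.toList ((codecW n).enc w) = encZ (ell n j) ((cand n j f).h₂ g w) := by
    rw [hashStr_eq_encZ _ hw, hdec]; rfl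
  have hF2 : (cand n j f).F₂ (w, g) = ((cand n j f).F₁ w, g, (cand n j f).h₂ g w) := rfl
  rw [hF2, encOut2, codecIn2, prod_enc, vector_enc, F2Str, List.take_append_of_le_length hw.ge, List.take_of_length_le hw.le,
    List.drop_append_of_le_length hw.ge, List.drop_of_length_le hw.le, List.nil_append, List.take_of_length_le hg.le,
    F1Str_enc hf, hh]

/-- **Step 3**: `F3Str f n j (code ((w, g), g₃)) = encOut3 (F₃ ((w, g), g₃))`. [cite: HaitnerEtAl2020, proof of Thm. 5.1, Step 3] -/
theorem F3Str_enc (hf : IsLengthPreserving f) (v : (Wv n × G2v n) × G3v n) :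
    F3Str f n j ((codecIn3 n).enc v) = encOut3 n ((cand n j f).F₃ v) := by
  rcases v with ⟨u, g₃⟩
  have hu : ((codecIn2 n).enc u).length = n2 n := (codecIn2 n).length_enc u
  have hg : g₃.toList.length = G3 n := List.Vector.toList_length g₃
  have hdec : (BitCodec.vector (m2 n)).dec (encOut2 n j ((cand n j f).F₂ u)) = ⟨encOut2 n j ((cand n j f).F₂ u), length_encOut2 n j _⟩ :=
    List.Vector.toList_injective (vector_dec_toList _ (length_encOut2 n j _))
  have hh : hashStr (m2 n) (r3 n) g₃.toList (encOut2 n j ((cand n j f).F₂ u)) = encZ (r3 n) ((cand n j f).h₃ g₃ ((cand n j f).F₂ u)) := by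
    rw [hashStr_eq_encZ _ (length_encOut2 n j _), hdec]; rfl
  have hF3 : (cand n j f).F₃ (u, g₃) = (g₃, (cand n j f).h₃ g₃ ((cand n j f).F₂ u)) := rfl
  rw [hF3, encOut3, codecIn3, prod_enc, vector_enc, F3Str, List.take_append_of_le_length hu.ge, List.take_of_length_le hu.le,
    List.drop_append_of_le_length hu.ge, List.drop_of_length_le hu.le, List.nil_append, List.take_of_length_le hg.le,
    F2Str_enc hf, hh]

/-- **Step 4 — the keyed candidate on codes is the abstract family**: for `y, x ∈ 𝔽₂^N`,
`candStr f n j (encZ y) (encZ x) = encOut3 (G_y(x))`. [cite: HaitnerEtAl2020, proof of Thm. 5.1, Step 4] -/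
theorem candStr_enc (hf : IsLengthPreserving f) (y x : Dv n) :
    candStr f n j (encZ (N n) y) (encZ (N n) x) = encOut3 n ((cand n j f).fam y x) := by
  rw [candStr, zipWith_xor_encZ, CandData.fam, ← zvec_enc, ← enc_cand_e (j := j) (f := f) (y + x), F3Str_enc hf]

/-- Hence string collisions are abstract collisions: `candStr (encZ y) (encZ x) = candStr (encZ y) (encZ x')` iff
`G_y(x) = G_y(x')`. [cite: HaitnerEtAl2020, proof of Thm. 5.1, Step 4] -/
theorem candStr_enc_eq_iff (hf : IsLengthPreserving f) (y x x' : Dv n) :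
    candStr f n j (encZ (N n) y) (encZ (N n) x) = candStr f n j (encZ (N n) y) (encZ (N n) x') ↔
      (cand n j f).fam y x = (cand n j f).fam y x' := by
  rw [candStr_enc hf, candStr_enc hf, (encOut3_injective n).eq_iff]

/-! ### The hypotheses of the combinatorial analysis that concern the instance -/

/-- `padV` separates distinct images of a length-preserving `f`. [folklore] -/
theorem padV_ne (hf : IsLengthPreserving f) (x x' : Xv n) (h : (cand n j f).f x ≠ (cand n j f).f x') :
    padV n ((cand n j f).f x) ≠ padV n ((cand n j f).f x') := by
  intro hp
  apply h
  show f x.toList = f x'.toList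
  have h1 := (BitCodec.vector n).enc_dec (f x.toList) (by rw [hf, List.Vector.toList_length]; rfl)
  have h2 := (BitCodec.vector n).enc_dec (f x'.toList) (by rw [hf, List.Vector.toList_length]; rfl)
  rw [← h1, ← h2]
  exact congrArg (BitCodec.vector n).enc hp

/-- **`PrefixPairwise`** for the instance (`ℓK = M(n+1)`, prefix lengths `< M ≤ M + 1`). [cite: HaitnerEtAl2020, §2.4 with Thm. 4.5] -/
theorem prefixPairwise_cand (hf : IsLengthPreserving f) : PrefixPairwise (cand n j f).f (cand n j f).hp (M n) :=
  prefixPairwise_affinePrefix _ (by rw [lK]) (Nat.le_succ _) (padV n) (padV_ne hf)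

/-- **`PrefixThreewise`** for the instance. [cite: HaitnerEtAl2020, §2.4 with Thm. 4.5] -/
theorem prefixThreewise_cand (hf : IsLengthPreserving f) : PrefixThreewise (cand n j f).f (cand n j f).hp (M n) :=
  prefixThreewise_affinePrefix _ (by rw [lK]) (Nat.le_succ _) (padV n) (padV_ne hf)

/-- The coded-tuple map is injective. [folklore] -/
theorem codecW_vec_injective : Function.Injective fun w : Wv n => (⟨(codecW n).enc w, (codecW n).length_enc w⟩ : List.Vector Bool (t n * d0 n)) :=
  fun _ _ h => (codecW n).enc_injective (congrArg List.Vector.toList h)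

/-- **Pairwise independence of the smoothing hash** `h₂` over all keys, on all tuples (`ℓ_j ≤ ℓmax`).
[cite: HaitnerEtAl2020, §2.4 and proof of Thm. 5.1, Step 2] -/
theorem isPairwiseIndep_h₂ (hj : j < Jp1 n) : LeftoverHash.IsPairwiseIndep univ (cand n j f).h₂ univ := by
  intro w _ w' _ hne y y'
  have hℓ : ell n j * (t n * d0 n + 1) ≤ G2 n := by rw [G2]; exact Nat.mul_le_mul_right _ (ell_le_lmax hj)
  have h := isPairwiseIndep_hashV hℓ (univ : Finset (List.Vector Bool (t n * d0 n))) _ (mem_univ _) _ (mem_univ _)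
    (fun h => hne (codecW_vec_injective h)) y y'
  exact h

/-- **Three-wise independence of the smoothing hash** `h₂`. [cite: HaitnerEtAl2020, §2.4 and proof of Thm. 5.1, Step 2] -/
theorem isThreewiseIndep_h₂ (hj : j < Jp1 n) : IsThreewiseIndep univ (cand n j f).h₂ univ := by
  intro w _ w' _ w'' _ h1 h2 h3 y y' y''
  have hℓ : ell n j * (t n * d0 n + 1) ≤ G2 n := by rw [G2]; exact Nat.mul_le_mul_right _ (ell_le_lmax hj)
  have h := card_filter_hashV_triple hℓ (x := ⟨(codecW n).enc w, (codecW n).length_enc w⟩)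
    (x' := ⟨(codecW n).enc w', (codecW n).length_enc w'⟩) (x'' := ⟨(codecW n).enc w'', (codecW n).length_enc w''⟩)
    (fun h => h1 (codecW_vec_injective h)) (fun h => h2 (codecW_vec_injective h)) (fun h => h3 (codecW_vec_injective h)) y y' y''
  rw [Fintype.card_fun, ZMod.card, Fintype.card_fin, card_univ, card_vector, Fintype.card_bool,
    show (2 ^ ell n j) ^ 3 = 2 ^ ell n j * 2 ^ ell n j * 2 ^ ell n j by ring]
  exact h

/-- **Pairwise independence of the final hash** `h₃` over all keys, on all `F₂`-outputs (`ℓ_j ≤ ℓmax`).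
[cite: HaitnerEtAl2020, §2.4 and proof of Thm. 5.1, Step 3] -/
theorem isPairwiseIndep_h₃ (hj : j < Jp1 n) : LeftoverHash.IsPairwiseIndep univ (cand n j f).h₃ univ := by
  intro u _ u' _ hne y y'
  have hℓ : r3 n * (m2 n + 1) ≤ G3 n := by rw [G3]
  have hinj : (⟨encOut2 n j u, length_encOut2 n j u⟩ : List.Vector Bool (m2 n)) ≠ ⟨encOut2 n j u', length_encOut2 n j u'⟩ :=
    fun h => hne (encOut2_injective n j (ell_le_lmax hj) (congrArg List.Vector.toList h))
  exact isPairwiseIndep_hashV hℓ (univ : Finset (List.Vector Bool (m2 n))) _ (mem_univ _) _ (mem_univ _) hinj y y'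

/-! ### Cardinalities -/

/-- `|𝔽₂^k| = 2^k`. [folklore] -/
theorem card_zfun (k : ℕ) : Fintype.card (Fin k → ZMod 2) = 2 ^ k := by rw [Fintype.card_fun, ZMod.card, Fintype.card_fin]

/-- `|Dom| = 2^{d₀}`. [folklore] -/
theorem card_Dom : Fintype.card (Dom n) = 2 ^ d0 n := (codecD n).card_eq

/-- `|W × G₂| = 2^{n₂}`. [folklore] -/
theorem card_W_G2 : Fintype.card (Wv n × G2v n) = 2 ^ n2 n := (codecIn2 n).card_eq

/-- `|R₃| = 2^{r₃}`. [folklore] -/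
theorem card_R3 : Fintype.card (R3v n) = 2 ^ r3 n := card_zfun _

/-- `|R₂| = 2^{ℓ_j}`. [folklore] -/
theorem card_R2 : Fintype.card (R2v n j) = 2 ^ ell n j := card_zfun _

/-- `|𝔽₂^N| = 2^N`. [folklore] -/
theorem card_Dv : Fintype.card (Dv n) = 2 ^ N n := card_zfun _

/-- **The one-bit shrink of Step 3**: `|W × G₂| = 2·|R₃|` (so `hR₃` of `CandData.tcr_prob_le` holds with equality).
[cite: HaitnerEtAl2020, proof of Thm. 5.1, Step 3] -/
theorem two_mul_card_R3 : Fintype.card (Wv n × G2v n) = 2 * Fintype.card (R3v n) := by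
  rw [card_W_G2, card_R3, ← r3_add_one, pow_succ, mul_comm]

/-- `1 < |Dom|`. [folklore] -/
theorem one_lt_card_Dom : 1 < Fintype.card (Dom n) := by
  rw [card_Dom]; exact Nat.one_lt_two_pow (by have := one_le_d0 n; omega)

end Instance

end HHRVW

end Literature.Computability.Cryptography
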